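import Summits.Ventures.LatticeQCDFlow.Scaling.UrnCompositionChainLaw

/-!
HONEST FRAMING: exact (Metropolis-corrected) sampling algorithms for lattice gauge theory; figures
of merit are autocorrelation/cost numbers at stated couplings and volumes; no continuum-physics
claim.

# LumpedCycleCompositionLaw — THE REFRESH-CYCLE CHAIN OF THE LUMPED STAR WITH ARBITRARY END-HUB LAWS: THE OPTIMAL END-HUB COUPLING IS A MARKOVIAN COUPLING, AND A
# PRODUCT CERTIFICATE ON THE EQUAL-HUB PAIRS GIVES `d(n) ≤ Ψ_max·(1−ρ)ⁿ` — ITEM 1 (i) AT ANY SWAP RATE IS ONE INEQUALITY ABOUT ONE-COPY END-HUB LAWS (lean-2 GEN-35, ours)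

Venture-side (OURS).  Cell `lqcd-flow` (pub-lqcd), unit `pub-lqcd-lean-2-g35`, 2026-08-29.  Chapter V (composition variables), file 9: the finite-`τ` frame.  State space `X` in bijection
(`hub`, `comp`; hypotheses `hinj`, `hsurj`, `hhub`) with the lumped states `(z, N)` of one copy right after a redraw — hub content `z`, full composition `N` (`Σ N = K+1`, `N(z) ≥ 1`).
One refresh cycle: the swap phase ends with hub content `a ∼ u_x` (ANY family of laws `u_x ≥ 0`, `Σ u_x = 1`, supported on `{a : N(a) ≥ 1}` — at `τ = ∞` the urn law of files 3–7, at finite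
swap odds the `σ`-resolvent of the hub chain of file 8), `a` is deleted and a fresh `z' ∼ μ_0` becomes the new hub: `P(x,x') = Σ_a u_x(a)·μ_0(hub x')·𝟙{comp x' + δ_a = comp x + δ_(hub x')}`.
Coupling: common `z'`, end hubs coupled optimally (LPW 4.7, tree).  Potential: `Ψ(x,y) = Δ(comp x, comp y)·F(x,y) + C·𝟙{hub x ≠ hub y}`, `F` an affine mass of the pair with hub term,
`F(x,y) = c + s(hub x) + s(hub y) + Σ_v r_v(comp x + comp y)(v)` — after one coupled step the hubs agree forever, so the hub-disagreement term is paid once.  RESULT: if on every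
EQUAL-HUB pair the end-hub laws satisfy the one-cycle inequality `Σ_{a,b} q_{xy}(a,b)·Δ(M^a_x,M^b_y)·(F + e_{xy} − r_a − r_b) ≤ (1−ρ)·Δ·F` (the product criterion of file 5 is a sufficient
condition), then `d(n) ≤ Ψ_max(1−ρ)ⁿ` with `Ψ_max = (K+1)F_max + C` (so `t_mix(ε) ≤ ⌈ρ⁻¹ log(Ψ_max/ε)⌉₊` by the tree's `mixingTime_le`; not restated).  Hypothesis-equations, no definitions.

## What is proved

* §1 **`lumped_target_unique`** (`Σ_{x'} μ_0(hub x')𝟙{comp x' + δ_a = comp x + δ_(hub x')}·g(hub x', comp x') = Σ_z μ_0(z)·g(z, M^a + δ_z)`), **`lumped_isRowStochastic`**,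
  **`lumped_isMarkovianCoupling`**.
* §2 **`lumped_mulVec_potential`** (`(Q·Ψ)(x,y) = Σ_{a,b} q(a,b)Δ(M^a_x,M^b_y)(F + e − r_a − r_b)`, the hub-disagreement term disappears), **`lumped_contract`** (equal-hub criterion +
  a bound `B ≤ (1−ρ)C` on every pair ⇒ `Q·Ψ ≤ (1−ρ)Ψ`), **`lumped_worstTvDist_le`** (`d(n) ≤ ((K+1)F_max + C)(1−ρ)ⁿ`).

Reading (no numerics implied): this is the plumbing of MEMO-gen35 §5(b) for the star at any swap rate; what remains of OPEN-MATH item 1 (i) is the equal-hub one-cycle inequality for the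
actual end-hub laws `u_(z,N)` of the star (typed for `τ = ∞` in file 6; toy-certified with a hub term at `τ ≥ 1`).  NOT CLAIMED: that inequality at finite `τ`.  Literature grade (cell
rule): OWN, elementary on the tree's LPW files; nothing cited as a fact; no new bib keys.
-/

open Finset Matrix
open Literature.Probability.MarkovChains

namespace Summit.Ventures.LatticeQCDFlow.Scaling

section Lumped
variable {X : Type*} [Fintype X] [DecidableEq X] {S : Type*} [Fintype S] [DecidableEq S]
variable {hub : X → S} {comp : X → S → ℕ} {K : ℕ} {μ0 r s : S → ℝ} {c C ρ Fmax : ℝ} {u : X → S → ℝ}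
variable {P : X → X → ℝ} {Q : Matrix (X × X) (X × X) ℝ} {Δ : (S → ℕ) → (S → ℕ) → ℕ} {F : X × X → ℝ} {Ψ : X × X → ℝ}

/-! ## §1 The cycle kernel and its coupling -/

omit [DecidableEq X] in
/-- **The target of a move is unique, hub by hub:** if `comp x = M + δ_a` then
`Σ_{x'} μ_0(hub x')·𝟙{comp x' + δ_a = comp x + δ_(hub x')}·g(hub x', comp x') = Σ_z μ_0(z)·g(z, M + δ_z)`. [ours] -/
theorem lumped_target_unique (hinj : ∀ x x', hub x = hub x' → comp x = comp x' → x = x') (hsum : ∀ x, ∑ v, comp x v = K + 1)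
    (hsurj : ∀ (z : S) (N : S → ℕ), ∑ v, N v = K + 1 → N z ≠ 0 → ∃ x, hub x = z ∧ comp x = N)
    {x : X} {M : S → ℕ} {a : S} (hM : comp x = M + Pi.single a 1) (g : S → (S → ℕ) → ℝ) :
    ∑ x', μ0 (hub x') * (if comp x' + Pi.single a 1 = comp x + Pi.single (hub x') 1 then g (hub x') (comp x') else 0)
      = ∑ z, μ0 z * g z (M + Pi.single z 1) := by
  have hK : ∑ v, M v = K := by
    have h := hsum x; rw [hM, urnChain_sum_single] at h; omega
  -- split the sum over `x'` according to `hub x'`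
  have hfib : ∀ x', μ0 (hub x') * (if comp x' + Pi.single a 1 = comp x + Pi.single (hub x') 1 then g (hub x') (comp x') else 0)
      = ∑ z, (if hub x' = z then μ0 z * (if comp x' + Pi.single a 1 = comp x + Pi.single z 1 then g z (comp x') else 0) else 0) := by
    intro x'; rw [Finset.sum_ite_eq]; simp
  simp_rw [hfib]
  rw [Finset.sum_comm]
  refine sum_congr rfl fun z _ => ?_
  have hT : ∑ v, (M + Pi.single z 1 : S → ℕ) v = K + 1 := by rw [urnChain_sum_single, hK]
  have hTz : (M + Pi.single z 1 : S → ℕ) z ≠ 0 := by simp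
  obtain ⟨x0, hx0h, hx0c⟩ := hsurj z _ hT hTz
  have hiff : ∀ x', comp x' + Pi.single a 1 = comp x + Pi.single z 1 ↔ comp x' = M + Pi.single z 1 := by
    intro x'
    rw [hM, show (M + Pi.single a 1 + Pi.single z 1 : S → ℕ) = (M + Pi.single z 1) + Pi.single a 1 by abel]
    exact ⟨fun h => add_right_cancel h, fun h => by rw [h]⟩
  simp_rw [hiff]
  rw [Finset.sum_eq_single x0]
  · rw [if_pos hx0h, if_pos hx0c, hx0c]
  · intro x' _ hx'
    by_cases h1 : hub x' = z
    · rw [if_pos h1, if_neg]; · simp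
      intro h2; exact hx' (hinj x' x0 (h1.trans hx0h.symm) (h2.trans hx0c.symm))
    · rw [if_neg h1]
  · intro h; exact absurd (mem_univ x0) h

omit [Fintype X] [DecidableEq X] [Fintype S] [DecidableEq S] in
/-- Legal deletions: `u_x(a) ≠ 0 ⇒ comp x = (comp x − δ_a) + δ_a`. [ours] -/
theorem lumped_survivor [DecidableEq S] (hlegal : ∀ x a, u x a ≠ 0 → comp x a ≠ 0) {x : X} {a : S} (h : u x a ≠ 0) :
    comp x = (comp x - Pi.single a 1) + Pi.single a 1 :=
  urnChain_survivor (comp x) (hlegal x a h)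

omit [DecidableEq X] in
/-- **`P` is a stochastic matrix.** [ours] -/
theorem lumped_isRowStochastic (hinj : ∀ x x', hub x = hub x' → comp x = comp x' → x = x') (hsum : ∀ x, ∑ v, comp x v = K + 1)
    (hsurj : ∀ (z : S) (N : S → ℕ), ∑ v, N v = K + 1 → N z ≠ 0 → ∃ x, hub x = z ∧ comp x = N)
    (hμ0 : ∀ v, 0 ≤ μ0 v) (hμ1 : ∑ v, μ0 v = 1) (hu0 : ∀ x a, 0 ≤ u x a) (hu1 : ∀ x, ∑ a, u x a = 1) (hlegal : ∀ x a, u x a ≠ 0 → comp x a ≠ 0)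
    (hP : ∀ x x', P x x' = ∑ a, u x a * (μ0 (hub x') * (if comp x' + Pi.single a 1 = comp x + Pi.single (hub x') 1 then (1 : ℝ) else 0))) :
    IsRowStochastic P := by
  refine ⟨fun x x' => ?_, fun x => ?_⟩
  · rw [hP]
    exact sum_nonneg fun a _ => mul_nonneg (hu0 x a) (mul_nonneg (hμ0 _) (by split_ifs <;> norm_num))
  · simp_rw [hP]
    rw [Finset.sum_comm]
    have hinner : ∀ a, ∑ x', u x a * (μ0 (hub x') * (if comp x' + Pi.single a 1 = comp x + Pi.single (hub x') 1 then (1 : ℝ) else 0)) = u x a := by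
      intro a
      by_cases hua : u x a = 0
      · simp [hua]
      · rw [← Finset.mul_sum, lumped_target_unique hinj hsum hsurj (lumped_survivor hlegal hua) (fun _ _ => (1 : ℝ))]
        simp_rw [mul_one]; rw [hμ1, mul_one]
    simp_rw [hinner]
    exact hu1 x

omit [DecidableEq X] in
/-- **`Q` is a Markovian coupling of `P`** (end hubs coupled optimally, fresh hub shared). [ours] -/
theorem lumped_isMarkovianCoupling (hinj : ∀ x x', hub x = hub x' → comp x = comp x' → x = x') (hsum : ∀ x, ∑ v, comp x v = K + 1)
    (hsurj : ∀ (z : S) (N : S → ℕ), ∑ v, N v = K + 1 → N z ≠ 0 → ∃ x, hub x = z ∧ comp x = N)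
    (hμ0 : ∀ v, 0 ≤ μ0 v) (hu0 : ∀ x a, 0 ≤ u x a) (hu1 : ∀ x, ∑ a, u x a = 1) (hlegal : ∀ x a, u x a ≠ 0 → comp x a ≠ 0)
    (hP : ∀ x x', P x x' = ∑ a, u x a * (μ0 (hub x') * (if comp x' + Pi.single a 1 = comp x + Pi.single (hub x') 1 then (1 : ℝ) else 0)))
    (hQ : ∀ x y x' y', Q (x, y) (x', y') = ∑ a, ∑ b, optimalCoupling (u x) (u y) a b * (μ0 (hub x')
      * (if comp x' + Pi.single a 1 = comp x + Pi.single (hub x') 1 then (1 : ℝ) else 0))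
      * ((if hub y' = hub x' then (1 : ℝ) else 0) * (if comp y' + Pi.single b 1 = comp y + Pi.single (hub y') 1 then (1 : ℝ) else 0))) :
    IsMarkovianCoupling P Q := by
  intro x y
  have hq := optimalCoupling_isCoupling (hu0 x) (hu0 y) (hu1 x) (hu1 y)
  refine ⟨fun x' y' => ?_, fun x' => ?_, fun y' => ?_⟩
  · show 0 ≤ Q (x, y) (x', y')
    rw [hQ]
    exact sum_nonneg fun a _ => sum_nonneg fun b _ => mul_nonneg (mul_nonneg (hq.1 a b) (mul_nonneg (hμ0 _) (by split_ifs <;> norm_num)))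
      (mul_nonneg (by split_ifs <;> norm_num) (by split_ifs <;> norm_num))
  · -- first marginal (sum over `y'`): the `y'`-factor sums to one for legal `b`
    show ∑ y', Q (x, y) (x', y') = P x x'
    simp_rw [hQ]
    rw [Finset.sum_comm, hP]
    refine sum_congr rfl fun a _ => ?_
    rw [Finset.sum_comm]
    have hb : ∀ b, ∑ y', optimalCoupling (u x) (u y) a b * (μ0 (hub x') * (if comp x' + Pi.single a 1 = comp x + Pi.single (hub x') 1 then (1 : ℝ) else 0))
        * ((if hub y' = hub x' then (1 : ℝ) else 0) * (if comp y' + Pi.single b 1 = comp y + Pi.single (hub y') 1 then (1 : ℝ) else 0))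
        = optimalCoupling (u x) (u y) a b * (μ0 (hub x') * (if comp x' + Pi.single a 1 = comp x + Pi.single (hub x') 1 then (1 : ℝ) else 0)) := by
      intro b
      by_cases hqz : optimalCoupling (u x) (u y) a b = 0
      · simp [hqz]
      · rw [← Finset.mul_sum]
        have hM := lumped_survivor hlegal (urnChain_support hq hqz).2
        -- `Σ_{y'} 𝟙{hub y' = hub x'}𝟙{comp y' = M + δ_(hub y')} = 1`: use `lumped_target_unique` with `μ0 := 𝟙{· = hub x'}`
        have h' : ∑ y', (if hub y' = hub x' then (1 : ℝ) else 0) * (if comp y' + Pi.single b 1 = comp y + Pi.single (hub y') 1 then (1 : ℝ) else 0) = 1 := by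
          rw [lumped_target_unique (μ0 := fun z => if z = hub x' then (1 : ℝ) else 0) hinj hsum hsurj hM (fun _ _ => (1 : ℝ))]
          simp
        rw [h', mul_one]
    simp_rw [hb]
    rw [← Finset.sum_mul, hq.2.1 a]
  · -- second marginal (sum over `x'`)
    show ∑ x', Q (x, y) (x', y') = P y y'
    simp_rw [hQ]
    rw [Finset.sum_comm, hP]
    -- reorder to `Σ_b Σ_a Σ_{x'}`
    rw [show (∑ a, ∑ x', ∑ b, optimalCoupling (u x) (u y) a b * (μ0 (hub x') * (if comp x' + Pi.single a 1 = comp x + Pi.single (hub x') 1 then (1 : ℝ) else 0))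
        * ((if hub y' = hub x' then (1 : ℝ) else 0) * (if comp y' + Pi.single b 1 = comp y + Pi.single (hub y') 1 then (1 : ℝ) else 0)))
        = ∑ b, ∑ a, ∑ x', optimalCoupling (u x) (u y) a b * (μ0 (hub x') * (if comp x' + Pi.single a 1 = comp x + Pi.single (hub x') 1 then (1 : ℝ) else 0))
        * ((if hub y' = hub x' then (1 : ℝ) else 0) * (if comp y' + Pi.single b 1 = comp y + Pi.single (hub y') 1 then (1 : ℝ) else 0)) by
      calc _ = ∑ a, ∑ b, ∑ x', optimalCoupling (u x) (u y) a b * (μ0 (hub x') * (if comp x' + Pi.single a 1 = comp x + Pi.single (hub x') 1 then (1 : ℝ) else 0))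
              * ((if hub y' = hub x' then (1 : ℝ) else 0) * (if comp y' + Pi.single b 1 = comp y + Pi.single (hub y') 1 then (1 : ℝ) else 0)) :=
            sum_congr rfl fun a _ => Finset.sum_comm
        _ = _ := Finset.sum_comm]
    refine sum_congr rfl fun b _ => ?_
    have ha : ∀ a, ∑ x', optimalCoupling (u x) (u y) a b * (μ0 (hub x') * (if comp x' + Pi.single a 1 = comp x + Pi.single (hub x') 1 then (1 : ℝ) else 0))
        * ((if hub y' = hub x' then (1 : ℝ) else 0) * (if comp y' + Pi.single b 1 = comp y + Pi.single (hub y') 1 then (1 : ℝ) else 0))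
        = optimalCoupling (u x) (u y) a b * (μ0 (hub y') * (if comp y' + Pi.single b 1 = comp y + Pi.single (hub y') 1 then (1 : ℝ) else 0)) := by
      intro a
      by_cases hqz : optimalCoupling (u x) (u y) a b = 0
      · simp [hqz]
      · have hM := lumped_survivor hlegal (urnChain_support hq hqz).1
        -- `Σ_{x'} μ0(hub x')𝟙{x'-cond}𝟙{hub y' = hub x'} = μ0(hub y')`
        have h := lumped_target_unique (μ0 := μ0) hinj hsum hsurj hM (fun z _ => if hub y' = z then (1 : ℝ) else 0)
        have hR : ∑ z, μ0 z * (if hub y' = z then (1 : ℝ) else 0) = μ0 (hub y') := by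
          simp_rw [mul_ite, mul_one, mul_zero]; rw [Finset.sum_ite_eq]; simp
        rw [hR] at h
        have hrw : ∀ x', optimalCoupling (u x) (u y) a b * (μ0 (hub x') * (if comp x' + Pi.single a 1 = comp x + Pi.single (hub x') 1 then (1 : ℝ) else 0))
            * ((if hub y' = hub x' then (1 : ℝ) else 0) * (if comp y' + Pi.single b 1 = comp y + Pi.single (hub y') 1 then (1 : ℝ) else 0))
            = (optimalCoupling (u x) (u y) a b * (if comp y' + Pi.single b 1 = comp y + Pi.single (hub y') 1 then (1 : ℝ) else 0))
              * (μ0 (hub x') * (if comp x' + Pi.single a 1 = comp x + Pi.single (hub x') 1 then (if hub y' = hub x' then (1 : ℝ) else 0) else 0)) := by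
          intro x'; split_ifs <;> ring
        simp_rw [hrw]
        rw [← Finset.mul_sum, h]
        ring
    simp_rw [ha]
    rw [← Finset.sum_mul, hq.2.2 b]

/-! ## §2 The potential with a hub-disagreement term, and the law -/

omit [DecidableEq X] in
/-- **`(Q·Ψ)(x,y)` in end-hub form.**  With `Ψ(x,y) = Δ(comp x, comp y)·F(x,y) + C·𝟙{hub x ≠ hub y}`,
`F(x,y) = c + s(hub x) + s(hub y) + Σ_v r_v(comp x v + comp y v)`:
`(Q·Ψ)(x,y) = Σ_{a,b} q_{xy}(a,b)·Δ(M^a_x, M^b_y)·(F(x,y) + e_{xy} − r_a − r_b)`, `e_{xy} = 2Σμ_0 s − s(hub x) − s(hub y) + 2Σ μ_0 r`. [ours] -/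
theorem lumped_mulVec_potential (hinj : ∀ x x', hub x = hub x' → comp x = comp x' → x = x') (hsum : ∀ x, ∑ v, comp x v = K + 1)
    (hsurj : ∀ (z : S) (N : S → ℕ), ∑ v, N v = K + 1 → N z ≠ 0 → ∃ x, hub x = z ∧ comp x = N)
    (hμ1 : ∑ v, μ0 v = 1) (hu0 : ∀ x a, 0 ≤ u x a) (hu1 : ∀ x, ∑ a, u x a = 1) (hlegal : ∀ x a, u x a ≠ 0 → comp x a ≠ 0)
    (hΔ : ∀ N N', Δ N N' = ∑ v, (N v - N' v))
    (hQ : ∀ x y x' y', Q (x, y) (x', y') = ∑ a, ∑ b, optimalCoupling (u x) (u y) a b * (μ0 (hub x')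
      * (if comp x' + Pi.single a 1 = comp x + Pi.single (hub x') 1 then (1 : ℝ) else 0))
      * ((if hub y' = hub x' then (1 : ℝ) else 0) * (if comp y' + Pi.single b 1 = comp y + Pi.single (hub y') 1 then (1 : ℝ) else 0)))
    (hF : ∀ x y, F (x, y) = c + s (hub x) + s (hub y) + ∑ v, r v * ((comp x v : ℝ) + (comp y v : ℝ)))
    (hΨ : ∀ x y, Ψ (x, y) = (Δ (comp x) (comp y) : ℝ) * F (x, y) + C * (if hub x = hub y then (0 : ℝ) else 1)) (x y : X) :
    (Q *ᵥ Ψ) (x, y) = ∑ a, ∑ b, optimalCoupling (u x) (u y) a b * ((Δ (comp x - Pi.single a 1) (comp y - Pi.single b 1) : ℝ)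
        * (F (x, y) + (2 * ∑ v, μ0 v * s v - s (hub x) - s (hub y) + 2 * ∑ v, μ0 v * r v) - r a - r b)) := by
  have hq := optimalCoupling_isCoupling (hu0 x) (hu0 y) (hu1 x) (hu1 y)
  simp only [Matrix.mulVec, dotProduct, Fintype.sum_prod_type]
  have step1 : ∀ x' y', Q (x, y) (x', y') * Ψ (x', y') = ∑ a, ∑ b, optimalCoupling (u x) (u y) a b * (μ0 (hub x')
      * (if comp x' + Pi.single a 1 = comp x + Pi.single (hub x') 1 then (1 : ℝ) else 0))
      * ((if hub y' = hub x' then (1 : ℝ) else 0) * (if comp y' + Pi.single b 1 = comp y + Pi.single (hub y') 1 then (1 : ℝ) else 0)) * Ψ (x', y') := by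
    intro x' y'
    rw [hQ, Finset.sum_mul]
    exact sum_congr rfl fun a _ => by rw [Finset.sum_mul]
  simp_rw [step1]
  -- fold the summand and reorder `Σ_{x'} Σ_{y'} Σ_a Σ_b = Σ_a Σ_b Σ_{x'} Σ_{y'}`
  set T : X → X → S → S → ℝ := fun x' y' a b => optimalCoupling (u x) (u y) a b * (μ0 (hub x')
      * (if comp x' + Pi.single a 1 = comp x + Pi.single (hub x') 1 then (1 : ℝ) else 0))
      * ((if hub y' = hub x' then (1 : ℝ) else 0) * (if comp y' + Pi.single b 1 = comp y + Pi.single (hub y') 1 then (1 : ℝ) else 0)) * Ψ (x', y') with hTdef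
  have hfold : ∀ x' y' a b, optimalCoupling (u x) (u y) a b * (μ0 (hub x')
      * (if comp x' + Pi.single a 1 = comp x + Pi.single (hub x') 1 then (1 : ℝ) else 0))
      * ((if hub y' = hub x' then (1 : ℝ) else 0) * (if comp y' + Pi.single b 1 = comp y + Pi.single (hub y') 1 then (1 : ℝ) else 0)) * Ψ (x', y') = T x' y' a b :=
    fun _ _ _ _ => rfl
  simp_rw [hfold]
  have hre : ∑ x', ∑ y', ∑ a, ∑ b, T x' y' a b = ∑ a, ∑ b, ∑ x', ∑ y', T x' y' a b := by
    calc ∑ x', ∑ y', ∑ a, ∑ b, T x' y' a b = ∑ x', ∑ a, ∑ y', ∑ b, T x' y' a b := sum_congr rfl fun x' _ => Finset.sum_comm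
      _ = ∑ a, ∑ x', ∑ y', ∑ b, T x' y' a b := Finset.sum_comm
      _ = ∑ a, ∑ x', ∑ b, ∑ y', T x' y' a b := sum_congr rfl fun a _ => sum_congr rfl fun x' _ => Finset.sum_comm
      _ = ∑ a, ∑ b, ∑ x', ∑ y', T x' y' a b := sum_congr rfl fun a _ => Finset.sum_comm
  rw [hre]
  simp only [hTdef]
  refine sum_congr rfl fun a _ => sum_congr rfl fun b _ => ?_
  by_cases hqab : optimalCoupling (u x) (u y) a b = 0
  · simp [hqab]
  obtain ⟨hxa, hyb⟩ := urnChain_support hq hqab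
  have hMx := lumped_survivor hlegal hxa
  have hMy := lumped_survivor hlegal hyb
  -- the sum over `y'` for fixed `x'`: unique `y'` with `hub y' = hub x'`, `comp y' = M_y + δ_(hub x')`
  have hy : ∀ x', ∑ y', optimalCoupling (u x) (u y) a b * (μ0 (hub x')
      * (if comp x' + Pi.single a 1 = comp x + Pi.single (hub x') 1 then (1 : ℝ) else 0))
      * ((if hub y' = hub x' then (1 : ℝ) else 0) * (if comp y' + Pi.single b 1 = comp y + Pi.single (hub y') 1 then (1 : ℝ) else 0)) * Ψ (x', y')
      = optimalCoupling (u x) (u y) a b * (μ0 (hub x') * (if comp x' + Pi.single a 1 = comp x + Pi.single (hub x') 1 then (1 : ℝ) else 0))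
        * ((Δ (comp x') (comp y - Pi.single b 1 + Pi.single (hub x') 1) : ℝ)
          * (c + s (hub x') + s (hub x') + ∑ v, r v * ((comp x' v : ℝ) + ((comp y - Pi.single b 1 + Pi.single (hub x') 1 : S → ℕ) v : ℝ)))) := by
    intro x'
    have h := lumped_target_unique (μ0 := fun z => if z = hub x' then (1 : ℝ) else 0) hinj hsum hsurj hMy
      (fun z N => (Δ (comp x') N : ℝ) * (c + s (hub x') + s z + ∑ v, r v * ((comp x' v : ℝ) + (N v : ℝ))))
    simp only [ite_mul, one_mul, zero_mul, Finset.sum_ite_eq', mem_univ, if_true] at h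
    rw [← h, Finset.mul_sum]
    refine sum_congr rfl fun y' _ => ?_
    rw [hΨ, hF x' y']
    by_cases h1 : hub y' = hub x'
    · simp only [h1, if_true, mul_zero, add_zero]
      split_ifs <;> ring
    · simp only [if_neg h1, zero_mul, mul_zero]
  simp_rw [hy]
  -- the sum over `x'`: `Σ_{x'} μ0(hub x')𝟙{x'-cond} g(hub x', comp x') = Σ_z μ0(z) g(z, M_x + δ_z)`
  have h := lumped_target_unique (μ0 := μ0) hinj hsum hsurj hMx
    (fun z N => (Δ N (comp y - Pi.single b 1 + Pi.single z 1) : ℝ) * (c + s z + s z + ∑ v, r v * ((N v : ℝ) + ((comp y - Pi.single b 1 + Pi.single z 1 : S → ℕ) v : ℝ))))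
  have h' : ∑ x', optimalCoupling (u x) (u y) a b * (μ0 (hub x') * (if comp x' + Pi.single a 1 = comp x + Pi.single (hub x') 1 then (1 : ℝ) else 0))
        * ((Δ (comp x') (comp y - Pi.single b 1 + Pi.single (hub x') 1) : ℝ)
          * (c + s (hub x') + s (hub x') + ∑ v, r v * ((comp x' v : ℝ) + ((comp y - Pi.single b 1 + Pi.single (hub x') 1 : S → ℕ) v : ℝ))))
      = optimalCoupling (u x) (u y) a b * ∑ x', μ0 (hub x') * (if comp x' + Pi.single a 1 = comp x + Pi.single (hub x') 1 then
          (Δ (comp x') (comp y - Pi.single b 1 + Pi.single (hub x') 1) : ℝ)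
          * (c + s (hub x') + s (hub x') + ∑ v, r v * ((comp x' v : ℝ) + ((comp y - Pi.single b 1 + Pi.single (hub x') 1 : S → ℕ) v : ℝ))) else 0) := by
    rw [Finset.mul_sum]
    refine sum_congr rfl fun x' _ => ?_
    split_ifs <;> ring
  rw [h', h]
  -- evaluate `Δ` and the masses at the targets
  have hmass : ∀ z, ∑ v, r v * (((comp x - Pi.single a 1 + Pi.single z 1 : S → ℕ) v : ℝ) + ((comp y - Pi.single b 1 + Pi.single z 1 : S → ℕ) v : ℝ))
      = ∑ v, r v * ((comp x v : ℝ) + (comp y v : ℝ)) - r a - r b + 2 * r z := by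
    intro z
    have e1 := urnChain_mass_add_single (θ := r) (comp x - Pi.single a 1) z
    have e2 := urnChain_mass_add_single (θ := r) (comp y - Pi.single b 1) z
    have e3 := urnChain_mass_add_single (θ := r) (comp x - Pi.single a 1) a
    have e4 := urnChain_mass_add_single (θ := r) (comp y - Pi.single b 1) b
    rw [← hMx] at e3; rw [← hMy] at e4
    simp only [mul_add, sum_add_distrib] at e1 e2 e3 e4 ⊢
    rw [e1, e2]
    linarith
  have hterm : ∀ z, μ0 z * ((Δ (comp x - Pi.single a 1 + Pi.single z 1) (comp y - Pi.single b 1 + Pi.single z 1) : ℝ)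
        * (c + s z + s z + ∑ v, r v * (((comp x - Pi.single a 1 + Pi.single z 1 : S → ℕ) v : ℝ) + ((comp y - Pi.single b 1 + Pi.single z 1 : S → ℕ) v : ℝ))))
      = μ0 z * ((Δ (comp x - Pi.single a 1) (comp y - Pi.single b 1) : ℝ) * (c + ∑ v, r v * ((comp x v : ℝ) + (comp y v : ℝ)) - r a - r b))
        + (μ0 z * s z) * (2 * (Δ (comp x - Pi.single a 1) (comp y - Pi.single b 1) : ℝ))
        + (μ0 z * r z) * (2 * (Δ (comp x - Pi.single a 1) (comp y - Pi.single b 1) : ℝ)) := by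
    intro z
    rw [cdist_add_single_same hΔ, hmass z]; ring
  simp_rw [hterm]
  rw [sum_add_distrib, sum_add_distrib, ← Finset.sum_mul, ← Finset.sum_mul, ← Finset.sum_mul, hμ1, one_mul, hF]
  ring

omit [DecidableEq X] in
/-- **CONTRACTION FROM THE EQUAL-HUB CRITERION:** if for every pair with `hub x = hub y` the end-hub laws satisfy
`Σ_{a,b} q(a,b)Δ(M^a_x,M^b_y)(F + e − r_a − r_b) ≤ (1−ρ)·Δ(comp x,comp y)·F(x,y)`, and for every pair the same quantity is at most `B` with `B ≤ (1−ρ)C`, then `Q·Ψ ≤ (1−ρ)·Ψ`. [ours] -/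
theorem lumped_contract (hinj : ∀ x x', hub x = hub x' → comp x = comp x' → x = x') (hsum : ∀ x, ∑ v, comp x v = K + 1)
    (hsurj : ∀ (z : S) (N : S → ℕ), ∑ v, N v = K + 1 → N z ≠ 0 → ∃ x, hub x = z ∧ comp x = N)
    (hμ1 : ∑ v, μ0 v = 1) (hu0 : ∀ x a, 0 ≤ u x a) (hu1 : ∀ x, ∑ a, u x a = 1) (hlegal : ∀ x a, u x a ≠ 0 → comp x a ≠ 0)
    (hΔ : ∀ N N', Δ N N' = ∑ v, (N v - N' v))
    (hQ : ∀ x y x' y', Q (x, y) (x', y') = ∑ a, ∑ b, optimalCoupling (u x) (u y) a b * (μ0 (hub x')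
      * (if comp x' + Pi.single a 1 = comp x + Pi.single (hub x') 1 then (1 : ℝ) else 0))
      * ((if hub y' = hub x' then (1 : ℝ) else 0) * (if comp y' + Pi.single b 1 = comp y + Pi.single (hub y') 1 then (1 : ℝ) else 0)))
    (hF : ∀ x y, F (x, y) = c + s (hub x) + s (hub y) + ∑ v, r v * ((comp x v : ℝ) + (comp y v : ℝ)))
    (hΨ : ∀ x y, Ψ (x, y) = (Δ (comp x) (comp y) : ℝ) * F (x, y) + C * (if hub x = hub y then (0 : ℝ) else 1))
    (hF0 : ∀ x y, 0 ≤ F (x, y)) {B : ℝ} (hρ1 : ρ ≤ 1) (hBC : B ≤ (1 - ρ) * C)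
    (hB : ∀ x y, ∑ a, ∑ b, optimalCoupling (u x) (u y) a b * ((Δ (comp x - Pi.single a 1) (comp y - Pi.single b 1) : ℝ)
        * (F (x, y) + (2 * ∑ v, μ0 v * s v - s (hub x) - s (hub y) + 2 * ∑ v, μ0 v * r v) - r a - r b)) ≤ B)
    (hcrit : ∀ x y, hub x = hub y → ∑ a, ∑ b, optimalCoupling (u x) (u y) a b * ((Δ (comp x - Pi.single a 1) (comp y - Pi.single b 1) : ℝ)
        * (F (x, y) + (2 * ∑ v, μ0 v * s v - s (hub x) - s (hub y) + 2 * ∑ v, μ0 v * r v) - r a - r b))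
        ≤ (1 - ρ) * ((Δ (comp x) (comp y) : ℝ) * F (x, y))) (xy : X × X) :
    (Q *ᵥ Ψ) xy ≤ (1 - ρ) * Ψ xy := by
  obtain ⟨x, y⟩ := xy
  rw [lumped_mulVec_potential hinj hsum hsurj hμ1 hu0 hu1 hlegal hΔ hQ hF hΨ x y, hΨ]
  by_cases hh : hub x = hub y
  · rw [if_pos hh, mul_zero, add_zero]; exact hcrit x y hh
  · rw [if_neg hh, mul_one]
    have hΔF : 0 ≤ (Δ (comp x) (comp y) : ℝ) * F (x, y) := mul_nonneg (Nat.cast_nonneg _) (hF0 x y)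
    calc _ ≤ B := hB x y
      _ ≤ (1 - ρ) * C := hBC
      _ ≤ (1 - ρ) * ((Δ (comp x) (comp y) : ℝ) * F (x, y) + C) := by nlinarith

/-- **THE LAW OF THE LUMPED CYCLE CHAIN FROM THE EQUAL-HUB CRITERION:** under the hypotheses of `lumped_contract`, with `1 ≤ F ≤ F_max` and `C ≥ 1`, for any stationary `π`:
`d(n) ≤ ((K+1)·F_max + C)·(1−ρ)ⁿ`. [ours] -/
theorem lumped_worstTvDist_le [Nonempty X] (hinj : ∀ x x', hub x = hub x' → comp x = comp x' → x = x') (hsum : ∀ x, ∑ v, comp x v = K + 1)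
    (hsurj : ∀ (z : S) (N : S → ℕ), ∑ v, N v = K + 1 → N z ≠ 0 → ∃ x, hub x = z ∧ comp x = N)
    (hμ0 : ∀ v, 0 ≤ μ0 v) (hμ1 : ∑ v, μ0 v = 1) (hu0 : ∀ x a, 0 ≤ u x a) (hu1 : ∀ x, ∑ a, u x a = 1) (hlegal : ∀ x a, u x a ≠ 0 → comp x a ≠ 0)
    (hΔ : ∀ N N', Δ N N' = ∑ v, (N v - N' v))
    (hP : ∀ x x', P x x' = ∑ a, u x a * (μ0 (hub x') * (if comp x' + Pi.single a 1 = comp x + Pi.single (hub x') 1 then (1 : ℝ) else 0)))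
    (hQ : ∀ x y x' y', Q (x, y) (x', y') = ∑ a, ∑ b, optimalCoupling (u x) (u y) a b * (μ0 (hub x')
      * (if comp x' + Pi.single a 1 = comp x + Pi.single (hub x') 1 then (1 : ℝ) else 0))
      * ((if hub y' = hub x' then (1 : ℝ) else 0) * (if comp y' + Pi.single b 1 = comp y + Pi.single (hub y') 1 then (1 : ℝ) else 0)))
    (hF : ∀ x y, F (x, y) = c + s (hub x) + s (hub y) + ∑ v, r v * ((comp x v : ℝ) + (comp y v : ℝ)))
    (hΨ : ∀ x y, Ψ (x, y) = (Δ (comp x) (comp y) : ℝ) * F (x, y) + C * (if hub x = hub y then (0 : ℝ) else 1))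
    (hF1 : ∀ x y, 1 ≤ F (x, y)) (hFmax : ∀ x y, F (x, y) ≤ Fmax) (hC1 : 1 ≤ C) {B : ℝ} (hρ1 : ρ ≤ 1) (hBC : B ≤ (1 - ρ) * C)
    (hB : ∀ x y, ∑ a, ∑ b, optimalCoupling (u x) (u y) a b * ((Δ (comp x - Pi.single a 1) (comp y - Pi.single b 1) : ℝ)
        * (F (x, y) + (2 * ∑ v, μ0 v * s v - s (hub x) - s (hub y) + 2 * ∑ v, μ0 v * r v) - r a - r b)) ≤ B)
    (hcrit : ∀ x y, hub x = hub y → ∑ a, ∑ b, optimalCoupling (u x) (u y) a b * ((Δ (comp x - Pi.single a 1) (comp y - Pi.single b 1) : ℝ)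
        * (F (x, y) + (2 * ∑ v, μ0 v * s v - s (hub x) - s (hub y) + 2 * ∑ v, μ0 v * r v) - r a - r b))
        ≤ (1 - ρ) * ((Δ (comp x) (comp y) : ℝ) * F (x, y)))
    {π : X → ℝ} (hπ : IsStationary π P) (hπ0 : ∀ x, 0 ≤ π x) (hπ1 : ∑ x, π x = 1) (n : ℕ) :
    worstTvDist P π n ≤ ((K + 1) * Fmax + C) * (1 - ρ) ^ n := by
  have hQc := lumped_isMarkovianCoupling hinj hsum hsurj hμ0 hu0 hu1 hlegal hP hQ
  have hF0 : ∀ x y, 0 ≤ F (x, y) := fun x y => zero_le_one.trans (hF1 x y)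
  have hcontr := lumped_contract hinj hsum hsurj hμ1 hu0 hu1 hlegal hΔ hQ hF hΨ hF0 hρ1 hBC hB hcrit
  have hQ0 : ∀ z z' : X × X, 0 ≤ Q z z' := fun z z' => by
    obtain ⟨x, y⟩ := z; obtain ⟨x', y'⟩ := z'
    exact (hQc x y).1 x' y'
  -- bounds on `Ψ`
  have hΨ0 : ∀ x y, 0 ≤ Ψ (x, y) := fun x y => by
    rw [hΨ]; exact add_nonneg (mul_nonneg (Nat.cast_nonneg _) (hF0 x y)) (mul_nonneg (zero_le_one.trans hC1) (by split_ifs <;> norm_num))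
  have hΨ1 : ∀ x y, x ≠ y → 1 ≤ Ψ (x, y) := fun x y hxy => by
    rw [hΨ]
    by_cases hh : hub x = hub y
    · rw [if_pos hh, mul_zero, add_zero]
      have hne : comp x ≠ comp y := fun h => hxy (hinj x y hh h)
      have hΔ1 : (1 : ℝ) ≤ (Δ (comp x) (comp y) : ℝ) := by
        have : Δ (comp x) (comp y) ≠ 0 := fun h0 => hne (eq_of_cdist_eq_zero hΔ (by rw [hsum x, hsum y]) h0)
        exact_mod_cast Nat.one_le_iff_ne_zero.mpr this
      nlinarith [hF1 x y]
    · rw [if_neg hh, mul_one]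
      nlinarith [mul_nonneg (Nat.cast_nonneg (Δ (comp x) (comp y)) : (0 : ℝ) ≤ _) (hF0 x y)]
  have hΨmax : ∀ x y, Ψ (x, y) ≤ (K + 1) * Fmax + C := fun x y => by
    rw [hΨ]
    have hΔle : (Δ (comp x) (comp y) : ℝ) ≤ K + 1 := by
      have := cdist_le_sum hΔ (comp x) (comp y); rw [hsum x] at this; exact_mod_cast this
    have h1 : (Δ (comp x) (comp y) : ℝ) * F (x, y) ≤ (K + 1) * Fmax :=
      mul_le_mul hΔle (hFmax x y) (hF0 x y) (by positivity)
    have h2 : C * (if hub x = hub y then (0 : ℝ) else 1) ≤ C := by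
      split_ifs
      · rw [mul_zero]; exact zero_le_one.trans hC1
      · rw [mul_one]
    linarith
  refine LevinPeres2017_cor_5_5 hπ hπ0 hπ1 fun x0 y0 => ⟨Q, hQc, ?_⟩
  set ind : X × X → ℝ := fun ab => if ab.1 = ab.2 then (0 : ℝ) else 1 with hind
  have hoff : ∑ a, ∑ b ∈ univ.erase a, kernelAt Q n (x0, y0) (a, b) = ((Q ^ n) *ᵥ ind) (x0, y0) := by
    simp only [Matrix.mulVec, dotProduct, Fintype.sum_prod_type]
    refine sum_congr rfl fun a _ => ?_
    have hdiag : (fun b => (Q ^ n) (x0, y0) (a, b) * ind (a, b)) a = 0 := by simp [hind]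
    have hsplit : ∑ b, (Q ^ n) (x0, y0) (a, b) * ind (a, b) = ∑ b ∈ univ.erase a, (Q ^ n) (x0, y0) (a, b) * ind (a, b) :=
      (Finset.sum_erase (f := fun b => (Q ^ n) (x0, y0) (a, b) * ind (a, b)) univ hdiag).symm
    rw [hsplit]
    refine sum_congr rfl fun b hb => ?_
    have hab : a ≠ b := (ne_of_mem_erase hb).symm
    rw [kernelAt_eq_pow_apply, hind]
    simp [hab]
  rw [hoff]
  have hind_le : ∀ ab : X × X, ind ab ≤ Ψ ab := by
    rintro ⟨a, b⟩
    by_cases hab : a = b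
    · rw [hind]; simp only [hab, if_true]; exact hΨ0 b b
    · rw [hind]; simp only [if_neg hab]; exact hΨ1 a b hab
  calc ((Q ^ n) *ᵥ ind) (x0, y0) ≤ ((Q ^ n) *ᵥ Ψ) (x0, y0) := urnChain_pow_mono hQ0 hind_le n (x0, y0)
    _ ≤ (1 - ρ) ^ n * Ψ (x0, y0) := urnChain_geometric hQ0 hρ1 hcontr n (x0, y0)
    _ ≤ (1 - ρ) ^ n * ((K + 1) * Fmax + C) := mul_le_mul_of_nonneg_left (hΨmax x0 y0) (pow_nonneg (by linarith) n)
    _ = ((K + 1) * Fmax + C) * (1 - ρ) ^ n := by ring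

end Lumped

end Summit.Ventures.LatticeQCDFlow.Scaling
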